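import Summits.AtomisticToContinuum.Crystallization.Theorems.OverbindingBudgetEnergyPinningFloor
import Summits.AtomisticToContinuum.Crystallization.Theorems.ChessboardParticlePlanesPeriodicWindowsHcpTrialEnergy

/-!
# OverbindingBudget · decomp-a2c lens-4 g34 — part XXII-D′: the trial-state bound `EnergyTrialBound (−0.71749)` and the cones XXV

Helper file under `--supports stmt-AtomisticToContinuum-31280` (RDEF = `Theses.OverbindingBudget.RobustDefectLimitWindows`); closes nothing.
Discharges the known energy leaf of parts XXII-B/XXII-C at the level of record `e₁ = −71749/100000` from two tree theorems — the periodic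
trial-state bound `ChargedEnergyGapNegative.limsup_div_le_energyPerParticle` and the certified relaxed-hcp lattice sum
`PeriodicWindowsSketch.stub_hcpTrialEnergy : ∃ a h, e(hcp(a, h)) ≤ −0.71749` (the level of record `−0.7175` awaits a built certificate module:
`OnePercentFccWindow.energyPerParticle_fccPC_aW_le` / `SquareWellLayerCake.StackingFaultSparsity.stub_offBoxRef`) — so that at the numbers of
record the energy cut of ★ `StackedCellPinningU (17/16) s₁ s₂ t₁ t₂` has exactly TWO open leaves, the cell certificates
E2T `StrainedCellEnergyT (17/16) s₁ s₂ (−71749/100000 + κ′)` and E2S `StrainedCellEnergyS (17/16) t₁ t₂ (−71749/100000 + κ′)` (any `κ′ > 0`).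
Kept in its own module so that parts XXII–XXII-C do not carry the certificate's import closure.
-/

noncomputable section

namespace Summit.AtomisticToContinuum.Crystallization.Theorems.OverbindingBudgetEnergyTrialHcp

open Literature.MathematicalPhysics.StatisticalMechanics (lennardJones groundStateEnergy)
open Summit.AtomisticToContinuum.Crystallization.Theses.OverbindingBudget (RobustDefectLimitWindows)
open Summit.AtomisticToContinuum.Crystallization.Theses.PricedLinkCensus (ChargedEnergyGap)
open Summit.AtomisticToContinuum.Crystallization.Theorems.OverbindingBudgetGradedBareness (CleanlessExcessT)
open Summit.AtomisticToContinuum.Crystallization.Theorems.OverbindingBudgetCoherentCut (CoherentResidual)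
open Summit.AtomisticToContinuum.Crystallization.Theorems.OverbindingBudgetUniformCutStatements (GrossCleanBallsU)
open Summit.AtomisticToContinuum.Crystallization.Theorems.OverbindingBudgetElasticSplitScale (CompressedVirialLaw)
open Summit.AtomisticToContinuum.Crystallization.Theorems.ChartedPlanarOrderTubeConvex (TubeConvexW' TubeConvexRef)
open Summit.AtomisticToContinuum.Crystallization.Theorems.OverbindingBudgetScaleWidening (DoorPeriodicW)
open Summit.AtomisticToContinuum.Crystallization.Theorems.OverbindingBudgetTwoShellShape (TwoShellShape BarlowGluingW)
open Summit.AtomisticToContinuum.Crystallization.Theorems.OverbindingBudgetStackedRigidityW (StackedReductionW GapStressVanishesW)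
open Summit.AtomisticToContinuum.Crystallization.Theorems.OverbindingBudgetStackedRigidityRef (RegistryPinningW)
open Summit.AtomisticToContinuum.Crystallization.Theorems.OverbindingBudgetRegistryCut (RegistryResidual RegistryTube RegistryMetric)
open Summit.AtomisticToContinuum.Crystallization.Theorems.OverbindingBudgetRegistryDichotomy (RegistryGeometryW BalancedLocus
  SqRegistryGeometryW SqBalancedHeight SqRegistryMetric)
open Summit.AtomisticToContinuum.Crystallization.Theorems.OverbindingBudgetRegistryDichotomyCW (RegistryMetricCW SqRegistryMetricCW)
open Summit.AtomisticToContinuum.Crystallization.Theorems.OverbindingBudgetEnergyPinning (StackedCellPinningU)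
open Summit.AtomisticToContinuum.Crystallization.Theorems.OverbindingBudgetEnergyPinningCut (EnergyTrialBound energyTrialBound_of_limsup_le
  StrainedCellEnergyT StrainedCellEnergyS)
open Summit.AtomisticToContinuum.Crystallization.Theorems.OverbindingBudgetEnergyPinningFloor (stackedCellPinningU_of_cellEnergy
  rdef_twentyfourth_of_recordK_energy rdef_twentyfourth_of_recordK_energy_ref)

/-- **`limsup_N E(N)/N ≤ −0.71749`** for the Lennard-Jones ground-state energy in `ℝ³` (a relaxed hcp trial state). [this file] -/
theorem limsup_groundStateEnergy_div_le_hcp49 :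
    Filter.limsup (fun N : ℕ => groundStateEnergy lennardJones 3 N / N) Filter.atTop ≤ -(71749 / 100000) := by
  obtain ⟨a, h, ha, hh, hle⟩ := PeriodicWindowsSketch.stub_hcpTrialEnergy
  exact (ChargedEnergyGapNegative.limsup_div_le_energyPerParticle _).trans hle

/-- ★ **a known energy leaf one notch above the level of record: `EnergyTrialBound (−71749/100000)`** (`−0.7175` pending a built certificate module). [this file] -/
theorem energyTrialBound_hcp49 : EnergyTrialBound (-(71749 / 100000)) :=
  energyTrialBound_of_limsup_le limsup_groundStateEnergy_div_le_hcp49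

/-- ★ **the energy cut at the level of record:** `StrainedCellEnergyT Λ₁ s₁ s₂ (−0.71749 + κ′) → StrainedCellEnergyS Λ₁ t₁ t₂ (−0.71749 + κ′) →
StackedCellPinningU Λ₁ s₁ s₂ t₁ t₂` (`0 < κ′`, `Λ₁ ≤ 17/16`). [this file] -/
theorem stackedCellPinningU_of_cellEnergy_hcp49 {Λ₁ s₁ s₂ t₁ t₂ κ' : ℝ} (hκ' : 0 < κ') (hΛ₁ : Λ₁ ≤ 17 / 16)
    (hT : StrainedCellEnergyT Λ₁ s₁ s₂ (-(71749 / 100000) + κ')) (hS : StrainedCellEnergyS Λ₁ t₁ t₂ (-(71749 / 100000) + κ')) :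
    StackedCellPinningU Λ₁ s₁ s₂ t₁ t₂ :=
  stackedCellPinningU_of_cellEnergy hκ' hΛ₁ energyTrialBound_hcp49 hT hS

/-- ★ **RDEF cone, TWENTY-FIFTH form at the numbers of record, energy level `−0.71749`: ENERGY PINNING, all known energy leaves discharged** (W′ currency): beneath 7d the
open energy leaves are exactly E2T `StrainedCellEnergyT (17/16) s₁ s₂ (−71749/100000 + κ′)` and E2S `StrainedCellEnergyS (17/16) t₁ t₂ (−71749/100000 + κ′)`
[CERT·M], for a `κ′ > 0` of the certifier's choosing. [this file] -/
theorem rdef_twentyfifth_of_recordK_energy49 (s₁ s₂ t₁ t₂ h₀ h₁ κ' : ℝ) (hκ' : 0 < κ') (hG : GrossCleanBallsU (1 / 250) 10)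
    (hCEG : ChargedEnergyGap) (hC : CompressedVirialLaw (1 / 250) 10) (hS : TwoShellShape (1 / 100) (3 / 50) (1 / 450)) (hB₂ : BarlowGluingW)
    (hD : DoorPeriodicW 2) (hSR : StackedReductionW 2 (17 / 16)) (hV : GapStressVanishesW (17 / 16))
    (hP : RegistryPinningW (17 / 16) (1 / 40) (3 / 16)) (hT : TubeConvexW' (17 / 16) (1 / 40))
    (hET : StrainedCellEnergyT (17 / 16) s₁ s₂ (-(71749 / 100000) + κ')) (hES : StrainedCellEnergyS (17 / 16) t₁ t₂ (-(71749 / 100000) + κ'))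
    (hGeo : RegistryGeometryW (17 / 16) s₁ s₂ h₀ (3 / 20)) (hBal : BalancedLocus s₁ s₂ h₀ (1 / 40)) (hR1 : RegistryResidual s₁ s₂ (1 / 250))
    (hR2 : RegistryTube s₁ s₂ (1 / 100) 1) (hMet : RegistryMetric s₁ s₂ (3 / 500)) (hSqGeo : SqRegistryGeometryW (17 / 16) t₁ t₂ h₁ (3 / 20))
    (hSqH : SqBalancedHeight t₁ t₂ h₁ (1 / 100)) (hSqMet : SqRegistryMetric t₁ t₂ h₁ (1 / 100) 0) (hCE : CleanlessExcessT)
    (hRes : CoherentResidual 10) : RobustDefectLimitWindows :=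
  rdef_twentyfourth_of_recordK_energy s₁ s₂ t₁ t₂ h₀ h₁ (-(71749 / 100000)) κ' hκ' hG hCEG hC hS hB₂ hD hSR hV hP hT energyTrialBound_hcp49 hET hES
    hGeo hBal hR1 hR2 hMet hSqGeo hSqH hSqMet hCE hRes

/-- ★ **RDEF cone, twenty-fifth form at the numbers of record, energy level `−0.71749`, reference-centred (CURRENCY OF RECORD): ENERGY PINNING, all known
energy leaves discharged.** [this file] -/
theorem rdef_twentyfifth_of_recordK_energy49_ref (s₁ s₂ t₁ t₂ h₀ h₁ κ' : ℝ) (hκ' : 0 < κ') (hG : GrossCleanBallsU (1 / 250) 10)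
    (hCEG : ChargedEnergyGap) (hC : CompressedVirialLaw (1 / 250) 10) (hS : TwoShellShape (1 / 100) (3 / 50) (1 / 450)) (hB₂ : BarlowGluingW)
    (hD : DoorPeriodicW 2) (hSR : StackedReductionW 2 (17 / 16)) (hV : GapStressVanishesW (17 / 16))
    (hP : RegistryPinningW (17 / 16) (1 / 40) (3 / 16)) (hT : TubeConvexRef (17 / 16) (1 / 40))
    (hET : StrainedCellEnergyT (17 / 16) s₁ s₂ (-(71749 / 100000) + κ')) (hES : StrainedCellEnergyS (17 / 16) t₁ t₂ (-(71749 / 100000) + κ'))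
    (hGeo : RegistryGeometryW (17 / 16) s₁ s₂ h₀ (3 / 20)) (hBal : BalancedLocus s₁ s₂ h₀ (1 / 40)) (hR1 : RegistryResidual s₁ s₂ (1 / 250))
    (hR2 : RegistryTube s₁ s₂ (1 / 100) 1) (hMet : RegistryMetricCW s₁ s₂ (3 / 500))
    (hSqGeo : SqRegistryGeometryW (17 / 16) t₁ t₂ h₁ (3 / 20)) (hSqH : SqBalancedHeight t₁ t₂ h₁ (1 / 100))
    (hSqMet : SqRegistryMetricCW t₁ t₂ h₁ (1 / 100) 0) (hCE : CleanlessExcessT) (hRes : CoherentResidual 10) : RobustDefectLimitWindows :=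
  rdef_twentyfourth_of_recordK_energy_ref s₁ s₂ t₁ t₂ h₀ h₁ (-(71749 / 100000)) κ' hκ' hG hCEG hC hS hB₂ hD hSR hV hP hT energyTrialBound_hcp49 hET
    hES hGeo hBal hR1 hR2 hMet hSqGeo hSqH hSqMet hCE hRes

end Summit.AtomisticToContinuum.Crystallization.Theorems.OverbindingBudgetEnergyTrialHcp

end
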